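import Summits.ResolutionOfSingularities.ResolutionOfSingularities.Theorems.WildQuotientsSummitReductionStubPairOrbitBlowupClaimOfCentre
import Literature.AlgebraicGeometry.Resolution.AlterationsSemiStableCodimTwoCentreFormal
import Summits.ResolutionOfSingularities.ResolutionOfSingularities.Theorems.WildQuotientsSummitReductionStubPairOrbitBlowupCentreFlatLemmas2
import HarnessLib

/-!
# `WildQuotients.SummitReduction` (stmt-ResolutionOfSingularities-16324), line `FramePerfect`:
# lemmas for stub C1 (`stub_pair_orbitBlowupCentreFlat`) — formal coordinates at the non-smooth
# points of a quasi-split `G`-semi-stable pair over an arbitrary field (de Jong 1996, 2.23 + 3.3)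

Route `ResolutionOfSingularities/WildQuotients`, crux `SummitReduction`; helper file of the line
skeleton (v8), stub C1. The scheme-level half of de Jong 1996, 2.23 + 3.3 for the pairs of the
line — `Y` regular, `D ⊆ Y` a strict normal crossings divisor, `f : X ⟶ Y` a semi-stable curve
smooth over `Y ∖ D` and QUASI-SPLIT (the line's rendering: at a non-smooth point `z`, the
completed fibre local ring is `κ(f z)⟦u, v⟧/(uv)` over `κ(f z)`), over an ARBITRARY field `k` and at
an ARBITRARY (not necessarily closed) non-smooth point `z`; the tree has this for Situation 4.23
over an algebraically closed field at closed points (`DeJong1996SplitNodalStructure_holds`,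
`DeJong1996.SemiStablePair.exists_nodeDeformationRing_prod_pow_compat`).

* `centreFlat_stalkMap_mem_radical_singFittingIdeal` — **3.1/3.3, "By assumption we have
  `V(h) ⊂ V(t₁ ⋯ t_r)`"**: the local equation of `D` at `f z` lies in `√Fitt₁(Ω_{X/Y})_z`, because
  `f` is smooth over `Y ∖ D` (Stacks 07ZC along the generisations,
  `exists_mem_fittingIdeal_notMem_of_specializes`);
* `centreFlat_exists_formalCoordinates` — **2.23 + 3.3 at a non-smooth point `z`**: a regular
  system of parameters `w = (t, s)` of `𝒪_{Y,f z}` adapted to `D` (`I(D)_{f z} = (∏_{i<r} wᵢ)`),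
  Cohen coordinates `eA : 𝒪̂_{Y,f z} ≅ Λ = κ(f z)⟦T₁, …, T_m⟧`, `wᵢ ↦ Tᵢ`, and
  `e : 𝒪̂_{X,z} ≅ Λ⟦u, v⟧/(uv - ∏ Tᵢ^{νᵢ})` with `νᵢ = 0` for `i ≥ r` and `e(f^# a) = C(eA â)` for all
  `a ∈ 𝒪_{Y,f z}` (the algebra is `centreFlat_exists_nodeDeformationRing_prod_pow_compat` of
  `…CentreFlatLemmas2`).
-/

-- the problem path `ResolutionOfSingularities/ResolutionOfSingularities` makes the conventional
-- namespace repeat a component, which `linter.dupNamespace` flags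
set_option linter.dupNamespace false

noncomputable section

open CategoryTheory CategoryTheory.Limits AlgebraicGeometry TopologicalSpace
open Literature.AlgebraicGeometry.Resolution
open Literature.AlgebraicGeometry.Resolution.DeJong1996
open Literature.AlgebraicGeometry
open Scheme.IdealSheafData IsLocalRing NodalDeformation

namespace Summit.ResolutionOfSingularities.ResolutionOfSingularities.Theorems

/-! ## 3.3: the local equation of `D` lies in `√Fitt₁(Ω_{X/Y})` -/

/-- **de Jong 1996, 3.3 ("By assumption we have `V(h) ⊂ V(t₁ ⋯ t_r)`"), rendered on
`𝒪_{X,z}`**: for a semi-stable curve `f : X ⟶ Y` over a regular locally Noetherian `Y`, smooth over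
`Y ∖ D` (`D` closed), and any point `z`, the image under `f^#` of a germ `a₀ ∈ I(D)_{f z}` lies in
the radical of the stalk `Fitt₁(Ω_{X/Y})_z` of the ideal of `Sing(f)`: a prime `Q ⊇ Fitt₁` of
`𝒪_{X,z}` is the prime of a generisation `x'` of `z` at which `f` is not smooth (Stacks 07ZC,
`exists_mem_fittingIdeal_notMem_of_specializes`, with 2.21: smooth iff `Ω` cyclic), so `f x' ∈ D`
and `a₀` dies in `κ(f x')`, whence `f^# a₀ ∈ Q`. [cite: DeJong1996, 3.3, p. 63] -/
theorem centreFlat_stalkMap_mem_radical_singFittingIdeal {X Y : Scheme.{0}}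
    (f : X ⟶ Y) (hss : IsSemiStableCurve f) {D : Set Y} (hD : IsClosed D)
    (hsm : Smooth (f ∣_ ⟨Dᶜ, hD.isOpen_compl⟩)) (z : X) {a₀ : Y.presheaf.stalk (f.base z)}
    (ha₀ : a₀ ∈ stalkIdeal (vanishingIdeal ⟨D, hD⟩) (f.base z)) :
    (f.stalkMap z).hom a₀ ∈ (Scheme.Hom.singFittingIdeal f z).radical := by
  haveI := hss.locallyOfFiniteType
  have h2 := DeJong1996SmoothIffDifferentialsCyclic_holds.{0}
  rw [Ideal.radical_eq_sInf, Submodule.mem_sInf]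
  rintro Q ⟨hFQ, hQ⟩
  haveI := hQ
  obtain ⟨x', hx', hQeq⟩ := exists_specializes_comap_stalkSpecializes_eq z Q
  have hy' : f.base x' ⤳ f.base z := hx'.map f.continuous
  -- `f x' ∈ D`: otherwise `f` is smooth at `x'` and `Fitt₁ ⊄ Q`
  have hxD : f.base x' ∈ D := by
    by_contra hxD
    let V : Y.Opens := ⟨Dᶜ, hD.isOpen_compl⟩
    haveI : Smooth (f ∣_ V) := hsm
    have hsmV : Smooth ((f ⁻¹ᵁ V).ι ≫ f) := by
      rw [← morphismRestrict_ι]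
      infer_instance
    have hcyc := (h2 X Y f hss x').mp ⟨f ⁻¹ᵁ V, hxD, hsmV⟩
    obtain ⟨d, hd, hdQ⟩ := exists_mem_fittingIdeal_notMem_of_specializes f hx' hcyc
    rw [← hQeq] at hdQ
    exact hdQ (hFQ hd)
  -- `a₀` lies in the prime of `f x'`, so `f^# a₀ ∈ Q`
  have h1 : a₀ ∈ primeOfSpecializes hy' := stalkIdeal_vanishingIdeal_le hy' hxD ha₀
  rw [hQeq, Ideal.mem_comap]
  change (f.stalkMap z ≫ X.presheaf.stalkSpecializes hx').hom a₀ ∈ maximalIdeal _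
  rw [← Scheme.Hom.stalkSpecializes_stalkMap f x' z hx', CommRingCat.hom_comp, RingHom.comp_apply]
  exact map_nonunit (f.stalkMap x').hom _ h1

/-! ## 2.23 + 3.3 at a non-smooth point of a quasi-split pair -/

/-- **de Jong 1996, 2.23 + 3.3 at a non-smooth point of a quasi-split semi-stable pair, over an
arbitrary field.** Let `Y → Spec k` be regular and locally Noetherian, `D ⊆ Y` a strict normal
crossings divisor, `X` locally Noetherian, `f : X ⟶ Y` a semi-stable curve smooth over `Y ∖ D`
with the line's quasi-split rendering at its non-smooth points, and `z ∈ X` a point at which `f`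
is not smooth. Then `f z ∈ D`, and there are: a regular system of parameters `w₁, …, w_m` of
`𝒪_{Y,f z}` with `I(D)_{f z} = (∏_{i<r} wᵢ)`; Cohen coordinates
`eA : 𝒪̂_{Y,f z} ≅ Λ = κ(f z)⟦T₁, …, T_m⟧`, `wᵢ ↦ Tᵢ`; exponents `ν` vanishing for `i ≥ r`; and
`e : 𝒪̂_{X,z} ≅ Λ⟦u, v⟧/(uv - ∏ Tᵢ^{νᵢ})` with `e(f^# a) = C(eA â)` for all `a` ("`B ≅ A'⟦u, v⟧/(Q - t₁^{n₁} ⋯ t_r^{n_r})`", 3.3,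
in the quasi-split case `A' = A`, `Q = uv` of 2.23). Assembly of
`centreFlat_exists_nodeDeformationRing_prod_pow_compat` with the local description of `D`
(`isStrictNormalCrossingsDivisor_iff_stalkIdeal`), the field `k ⊆ 𝒪_{Y,f z}`, and 3.3 in the form
`centreFlat_stalkMap_mem_radical_singFittingIdeal`. [cite: DeJong1996, 2.23 and 3.3, pp. 61–63]
[cite: DeJong1997, 5.7, p. 614] -/
theorem centreFlat_exists_formalCoordinates {k : Type} [Field k] {X Y : Scheme.{0}}
    [IsLocallyNoetherian X] [IsLocallyNoetherian Y] (q : Y ⟶ Spec (.of k))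
    (hreg : Scheme.IsRegular Y) {D : Set Y} (hD : IsStrictNormalCrossingsDivisor Y D)
    (f : X ⟶ Y) (hss : IsSemiStableCurve f)
    (hqs : (∀ x : X, (¬ ∃ U : X.Opens, x ∈ U ∧ Smooth (U.ι ≫ f)) →
        ∃ e : AdicCompletion
            ((IsLocalRing.maximalIdeal (X.presheaf.stalk x)).map (Ideal.Quotient.mk
              ((IsLocalRing.maximalIdeal (Y.presheaf.stalk (f.base x))).map (f.stalkMap x).hom)))
            (X.presheaf.stalk x ⧸
              (IsLocalRing.maximalIdeal (Y.presheaf.stalk (f.base x))).map (f.stalkMap x).hom) ≃+*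
          MvPowerSeries (Fin 2) (Y.presheaf.stalk (f.base x) ⧸ IsLocalRing.maximalIdeal (Y.presheaf.stalk (f.base x))) ⧸
            Ideal.span {(MvPowerSeries.X 0 * MvPowerSeries.X 1 :
              MvPowerSeries (Fin 2) (Y.presheaf.stalk (f.base x) ⧸ IsLocalRing.maximalIdeal (Y.presheaf.stalk (f.base x))))},
          e.toRingHom.comp ((algebraMap (X.presheaf.stalk x ⧸
              (IsLocalRing.maximalIdeal (Y.presheaf.stalk (f.base x))).map (f.stalkMap x).hom) _).comp
            (Ideal.quotientMap ((IsLocalRing.maximalIdeal (Y.presheaf.stalk (f.base x))).map (f.stalkMap x).hom)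
              (f.stalkMap x).hom Ideal.le_comap_map)) =
          algebraMap (Y.presheaf.stalk (f.base x) ⧸ IsLocalRing.maximalIdeal (Y.presheaf.stalk (f.base x))) _))
    (hsm : Smooth (f ∣_ ⟨Dᶜ, hD.isClosed.isOpen_compl⟩))
    {z : X} (hns : ¬ ∃ U : X.Opens, z ∈ U ∧ Smooth (U.ι ≫ f)) :
    ∃ (m r : ℕ) (w : Fin m → Y.presheaf.stalk (f.base z)) (ν : Fin m → ℕ)
      (eA : Cpl (Y.presheaf.stalk (f.base z)) ≃+*
        MvPowerSeries (Fin m) (ResidueField (Y.presheaf.stalk (f.base z))))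
      (e : Cpl (X.presheaf.stalk z) ≃+*
        NodeDeformationRing (MvPowerSeries (Fin m) (ResidueField (Y.presheaf.stalk (f.base z))))
          (∏ i, MvPowerSeries.X i ^ ν i)),
      f.base z ∈ D ∧
      Ideal.span (Set.range w) = maximalIdeal (Y.presheaf.stalk (f.base z)) ∧
      stalkIdeal (vanishingIdeal ⟨D, hD.isClosed⟩) (f.base z) =
        Ideal.span {∏ i ∈ Finset.univ.filter (fun i : Fin m => i.val < r), w i} ∧
      (∀ i : Fin m, r ≤ i.val → ν i = 0) ∧
      (∀ i, eA (algebraMap _ _ (w i)) = MvPowerSeries.X i) ∧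
      ∀ a, e (algebraMap _ _ ((f.stalkMap z).hom a)) =
        Ideal.Quotient.mk _ (MvPowerSeries.C (eA (algebraMap _ _ a))) := by
  haveI := hss.locallyOfFiniteType
  haveI : Flat f := hss.flat
  -- the local rings `A → B`
  let A := Y.presheaf.stalk (f.base z)
  let B := X.presheaf.stalk z
  letI algAB : Algebra A B := (f.stalkMap z).hom.toAlgebra
  haveI : IsLocalHom (algebraMap A B) := inferInstanceAs (IsLocalHom (f.stalkMap z).hom)
  haveI : Algebra.EssFiniteType A B := by
    rw [← RingHom.essFiniteType_algebraMap, RingHom.algebraMap_toAlgebra]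
    exact LocallyOfFiniteType.stalkMap f z
  haveI : IsRegularLocalRing A := hreg (f.base z)
  -- 3.1: `f z ∈ D`
  have hfzD : f.base z ∈ D := by
    by_contra hzD
    let V : Y.Opens := ⟨Dᶜ, hD.isClosed.isOpen_compl⟩
    haveI : Smooth (f ∣_ V) := hsm
    have hsmV : Smooth ((f ⁻¹ᵁ V).ι ≫ f) := by
      rw [← morphismRestrict_ι]
      infer_instance
    exact hns ⟨f ⁻¹ᵁ V, hzD, hsmV⟩
  -- the regular system of parameters adapted to `D`
  obtain ⟨-, ρ, e₀, t, s, -, hdim, hspan, hI⟩ :=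
    ((isStrictNormalCrossingsDivisor_iff_stalkIdeal Y D).mp hD).2 (f.base z) hfzD
  have hcl : (⟨closure D, isClosed_closure⟩ : Closeds Y) = ⟨D, hD.isClosed⟩ :=
    Closeds.ext hD.isClosed.closure_eq
  rw [hcl] at hI
  set m := ρ + e₀ with hm
  set w : Fin m → A := Fin.append t s with hw
  have hspanW : Ideal.span (Set.range w) = maximalIdeal A := by rw [hw, range_fin_append, hspan]
  have hIW : stalkIdeal (vanishingIdeal ⟨D, hD.isClosed⟩) (f.base z) =
      Ideal.span {∏ i ∈ Finset.univ.filter (fun i : Fin m => i.val < ρ), w i} := by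
    rw [hI, hw, Fin.prod_filter_lt_append]
  -- the field `k ⊆ 𝒪_{Y,f z}`
  let φ : k →+* A :=
    (Y.presheaf.germ ⊤ (f.base z) trivial).hom.comp
      (q.appTop.hom.comp (Scheme.ΓSpecIso (.of k)).inv.hom)
  have hφ : Function.Injective φ := φ.injective
  let k₀ : Subring A := φ.range
  have hk₀ : IsField k₀ :=
    MulEquiv.isField (Field.toIsField k) (RingEquiv.ofBijective φ.rangeRestrict
      ⟨fun a b h => hφ (congrArg Subtype.val h), φ.rangeRestrict_surjective⟩).symm.toMulEquiv
  -- 3.3: a power of `∏_{i<ρ} wᵢ` lies in `Fitt₁`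
  have hFitt : ∃ N : ℕ,
      (algebraMap A B (∏ i ∈ Finset.univ.filter (fun i : Fin m => i.val < ρ), w i)) ^ N ∈
        Literature.RingTheory.FittingIdeal.Module.fittingIdeal B Ω[B⁄A] 1 := by
    have hmem : (∏ i ∈ Finset.univ.filter (fun i : Fin m => i.val < ρ), w i) ∈
        stalkIdeal (vanishingIdeal ⟨D, hD.isClosed⟩) (f.base z) := by
      rw [hIW]
      exact Ideal.mem_span_singleton_self _
    exact Ideal.mem_radical_iff.mp
      (centreFlat_stalkMap_mem_radical_singFittingIdeal f hss hD.isClosed hsm z hmem)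
  -- 2.23 + 3.3
  obtain ⟨eqs, heqs⟩ := hqs z hns
  obtain ⟨ν, eA, e, hν, heA, he⟩ := centreFlat_exists_nodeDeformationRing_prod_pow_compat
    (A := A) (B := B) (Flat.stalkMap f z) eqs heqs k₀ hk₀ ρ w hspanW hdim hFitt
  exact ⟨m, ρ, w, ν, eA, e, hfzD, hspanW, hIW, hν, heA, he⟩

end Summit.ResolutionOfSingularities.ResolutionOfSingularities.Theorems

end
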